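import Summits.AnomalousDissipation.AnomalousDissipation.Theorems.DenseLoudDesignerForces.Negative.PowerBudget
import HarnessLib

/-!
# Strategist census, generation 1 — checked signatures (crux `BaireTransfer.DenseLoudDesignerForces`, stmt-AnomalousDissipation-1143)

Companion of `Cruxes/DenseLoudDesignerForces/STRATEGY-CENSUS.md` (crux-strategist gen 1, seat
`planner-cstrat-stmt-AnomalousDissipation-1143-s1-0`, 2026-08-17).  It TYPES the new objects this census argues
about (the p1 file `StrategistCensus.lean` keeps S⁺₁, D1, D2):

* §N NEGATION — the ASYMPTOTIC LOUD SET `L_∞(S,E,ε) := ⋂ⱼ closure LOUD_j(S,E,ε)` (closed; by antitonicity any tail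
  of levels gives the same set), the interior form of the crux (`denseLoudDesignerForces_iff_interior`: some `L_∞`
  has an interior point) and of a kill (`not_denseLoudDesignerForces_iff_nowhereDense`: every `L_∞` is nowhere dense).
* §D8 DECOMPOSITION — `LoudSomewhereInWindow` (existence of ONE loud force inside a fixed window at every level;
  certified NECESSARY, `loudSomewhereInWindow_of_crux`) and `LocalToDense` (propagation: one loud force in an open
  set makes the budget-relaxed loud set dense there), with the glue `denseLoudDesignerForces_of_somewhere_of_localToDense`.
* §S STRENGTHEN — `DenseLoudBoundedPeriodForces` (S⁺_τ: witnesses with periods bounded uniformly in the level) and the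
  adapter `denseLoudDesignerForces_of_bddPeriod`.

Nothing is asserted: every `def` is a `Prop` or a `Set`, every theorem is an implication or an `Iff`.  No `sorry`.
-/

noncomputable section

set_option linter.dupNamespace false

namespace Summit.AnomalousDissipation.AnomalousDissipation.Cruxes.DenseLoudDesignerForces.StrategistCensusS1

open scoped Topology
open Filter Set MeasureTheory
open Literature.Analysis.FunctionSpaces Literature.Analysis.FluidPDE
open Summit.AnomalousDissipation.AnomalousDissipation.Theses.BaireTransfer
open Summit.AnomalousDissipation.AnomalousDissipation.Theorems.DenseLoudDesignerForces.Negative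

/-- Complex Fourier coefficient values. -/
local notation "ℂ³" => EuclideanSpace ℂ (Fin 3)
/-- The flat unit torus. -/
local notation "𝕋³" => UnitAddTorus (Fin 3)
/-- Velocity values. -/
local notation "ℝ³" => EuclideanSpace ℝ (Fin 3)

variable {S : Finset (Fin 3 → ℤ)} {E ε : ℝ}

/-! ## §N NEGATION: the asymptotic loud set; interior form of the crux and of a kill -/

/-- The ASYMPTOTIC LOUD SET `L_∞(S,E,ε) = ⋂ⱼ closure LOUD_j(S,E,ε)`: forces that are, at EVERY level, limits of
level-`j`-loud forces of the same stock and budgets. -/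
def asymptoticLoudSet (S : Finset (Fin 3 → ℤ)) (E ε : ℝ) : Set (↥S → ℂ³) :=
  ⋂ j : ℕ, closure (loudSet S E ε j)

theorem isClosed_asymptoticLoudSet (S : Finset (Fin 3 → ℤ)) (E ε : ℝ) :
    IsClosed (asymptoticLoudSet S E ε) :=
  isClosed_iInter fun _ => isClosed_closure

/-- Any tail of levels already gives `L_∞` (the loud sets are antitone in the level). -/
theorem asymptoticLoudSet_eq_iInter_ge (S : Finset (Fin 3 → ℤ)) (E ε : ℝ) (j₀ : ℕ) :
    asymptoticLoudSet S E ε = ⋂ j : ℕ, ⋂ (_ : j₀ ≤ j), closure (loudSet S E ε j) := by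
  apply Subset.antisymm
  · exact subset_iInter₂ fun j _ => iInter_subset _ j
  · refine subset_iInter fun j => ?_
    exact (iInter₂_subset (max j j₀) (le_max_right _ _)).trans
      (closure_mono (loudSet_antitone S E ε (le_max_left _ _)))

/-- A window is exactly a non-empty open subset of `L_∞`. -/
theorem isWindow_iff_subset_asymptoticLoudSet {U : Set (↥S → ℂ³)} :
    IsWindow S E ε U ↔ IsOpen U ∧ U.Nonempty ∧ U ⊆ asymptoticLoudSet S E ε := by
  simp only [IsWindow, asymptoticLoudSet, subset_iInter_iff]

/-- Windows exist iff `L_∞` has an interior point. -/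
theorem exists_isWindow_iff_interior_nonempty :
    (∃ U : Set (↥S → ℂ³), IsWindow S E ε U) ↔ (interior (asymptoticLoudSet S E ε)).Nonempty := by
  constructor
  · rintro ⟨U, hU⟩
    rw [isWindow_iff_subset_asymptoticLoudSet] at hU
    obtain ⟨hUo, ⟨c, hc⟩, hsub⟩ := hU
    exact ⟨c, interior_maximal hsub hUo hc⟩
  · intro h
    exact ⟨interior (asymptoticLoudSet S E ε),
      isWindow_iff_subset_asymptoticLoudSet.2 ⟨isOpen_interior, h, interior_subset⟩⟩

/-- **Interior form of the crux**: for every stock `S₀` some `S ⊇ S₀` and budgets make `L_∞(S,E,ε)` somewhere dense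
(it is closed, so: it has an interior point). -/
theorem denseLoudDesignerForces_iff_interior :
    DenseLoudDesignerForces ↔
      ∀ S₀ : Finset (Fin 3 → ℤ), ∃ S : Finset (Fin 3 → ℤ), S₀ ⊆ S ∧ ∃ (E ε : ℝ), 0 < ε ∧
        (interior (asymptoticLoudSet S E ε)).Nonempty := by
  rw [denseLoudDesignerForces_iff]
  refine forall_congr' fun S₀ => exists_congr fun S => and_congr_right fun _ => ?_
  refine exists_congr fun E => exists_congr fun ε => and_congr_right fun _ => ?_
  exact exists_isWindow_iff_interior_nonempty

/-- **Interior form of a kill**: some stock `S₀` such that for all `S ⊇ S₀` and all budgets the closed set `L_∞(S,E,ε)`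
is NOWHERE DENSE (empty interior).  Since only generic points of arbitrary open sets of `P_S` are available to the
refuter, this is a uniform local-quietness theorem for fixed-degree steady forcing — the negation of the zeroth law on
that force class restricted to periodic classical witnesses. -/
theorem not_denseLoudDesignerForces_iff_nowhereDense :
    ¬ DenseLoudDesignerForces ↔
      ∃ S₀ : Finset (Fin 3 → ℤ), ∀ S : Finset (Fin 3 → ℤ), S₀ ⊆ S → ∀ (E ε : ℝ), 0 < ε →
        interior (asymptoticLoudSet S E ε) = ∅ := by
  rw [denseLoudDesignerForces_iff_interior]
  push Not
  rfl

/-! ## §D8 DECOMPOSITION: existence-somewhere ∧ local-to-dense propagation -/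

/-- **Sub_A — LOUD SOMEWHERE IN A FIXED WINDOW AT EVERY LEVEL** (no density): for every stock `S₀` there are
`S ⊇ S₀`, budgets and an open non-empty `U ⊆ P_S` such that at every level SOME force of `U` is loud.  Strictly weaker
than the crux (certified necessary below) and still the designer/UPO zeroth law: loud bounded periodic classical
orbits at arbitrarily small `ν` for steady forces of fixed degree and bounded amplitude. -/
def LoudSomewhereInWindow : Prop :=
  ∀ S₀ : Finset (Fin 3 → ℤ), ∃ S : Finset (Fin 3 → ℤ), S₀ ⊆ S ∧ ∃ (E ε : ℝ), 0 < ε ∧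
    ∃ U : Set (↥S → ℂ³), IsOpen U ∧ U.Nonempty ∧ ∀ j : ℕ, (U ∩ loudSet S E ε j).Nonempty

/-- **Sub_B — LOCAL-TO-DENSE PROPAGATION** (a transitivity law for loudness in the force parameter): one loud force
inside an open set of forces makes the budget-relaxed loud set of the same level dense in that open set.  Budget-blind
as a mechanism (global continuation of periodic orbits in the parameter `c`); false for isolas. -/
def LocalToDense : Prop :=
  ∀ (S : Finset (Fin 3 → ℤ)) (E ε : ℝ) (U : Set (↥S → ℂ³)), IsOpen U → ∀ j : ℕ,
    (U ∩ loudSet S E ε j).Nonempty → U ⊆ closure (loudSet S (2 * E) (ε / 2) j)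

/-- Sub_A is NECESSARY: a window meets every level's loud set. -/
theorem loudSomewhereInWindow_of_crux (h : DenseLoudDesignerForces) : LoudSomewhereInWindow := by
  rw [denseLoudDesignerForces_iff] at h
  intro S₀
  obtain ⟨S, hS, E, ε, hε, U, hUo, ⟨c, hc⟩, hW⟩ := h S₀
  refine ⟨S, hS, E, ε, hε, U, hUo, ⟨c, hc⟩, fun j => ?_⟩
  have hcl : c ∈ closure (loudSet S E ε j) := hW j hc
  rw [mem_closure_iff] at hcl
  obtain ⟨x, hxU, hxL⟩ := hcl U hUo hc
  exact ⟨x, hxU, hxL⟩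

/-- **Glue D8**: `Sub_A → Sub_B → crux` (budgets `(2E, ε/2)`). -/
theorem denseLoudDesignerForces_of_somewhere_of_localToDense (h₁ : LoudSomewhereInWindow) (h₂ : LocalToDense) :
    DenseLoudDesignerForces := by
  rw [denseLoudDesignerForces_iff]
  intro S₀
  obtain ⟨S, hS, E, ε, hε, U, hUo, hne, hj⟩ := h₁ S₀
  exact ⟨S, hS, 2 * E, ε / 2, by positivity, U, hUo, hne, fun j => h₂ S E ε U hUo j (hj j)⟩

/-! ## §S STRENGTHEN: witnesses with periods bounded uniformly in the level (S⁺_τ) -/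

/-- Loud forces at level `j` whose witness has period `τ ≤ τ₀`. -/
def bddPeriodLoudSet (S : Finset (Fin 3 → ℤ)) (E ε τ₀ : ℝ) (j : ℕ) : Set (↥S → ℂ³) :=
  {c | ∃ ν : ℝ, 0 < ν ∧ ν < 1 / ((j : ℝ) + 1) ∧
    ∃ (τ : ℝ) (u : ℝ → 𝕋³ → ℝ³) (p : ℝ → 𝕋³ → ℝ), 0 < τ ∧ τ ≤ τ₀ ∧
      Torus.IsClassicalNSSolutionOn Set.univ ν (fun _ => force S c) u p ∧
      Function.Periodic u τ ∧ meanEnergy u ≤ E ∧ ε ≤ meanDissipation ν u}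

/-- **S⁺_τ — DENSE LOUD DESIGNER FORCES WITH UNIFORMLY BOUNDED PERIODS**: the crux with one period ceiling `τ₀` for all
levels (time-compactness of the witness class at each fixed `ν`). -/
def DenseLoudBoundedPeriodForces : Prop :=
  ∀ S₀ : Finset (Fin 3 → ℤ), ∃ S : Finset (Fin 3 → ℤ), S₀ ⊆ S ∧ ∃ (E ε τ₀ : ℝ), 0 < ε ∧
    ∃ U : Set (↥S → ℂ³), IsOpen U ∧ U.Nonempty ∧ ∀ j : ℕ, U ⊆ closure (bddPeriodLoudSet S E ε τ₀ j)

theorem bddPeriodLoudSet_subset_loudSet (S : Finset (Fin 3 → ℤ)) (E ε τ₀ : ℝ) (j : ℕ) :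
    bddPeriodLoudSet S E ε τ₀ j ⊆ loudSet S E ε j := by
  rintro c ⟨ν, hν, hνj, τ, u, p, hτ, -, hsol, hper, hEu, hεu⟩
  exact ⟨ν, hν, hνj, τ, u, p, hτ, hsol, hper, hEu, hεu⟩

/-- Adapter `S⁺_τ → crux`. -/
theorem denseLoudDesignerForces_of_bddPeriod (h : DenseLoudBoundedPeriodForces) : DenseLoudDesignerForces := by
  rw [denseLoudDesignerForces_iff]
  intro S₀
  obtain ⟨S, hS, E, ε, τ₀, hε, U, hUo, hne, hW⟩ := h S₀
  exact ⟨S, hS, E, ε, hε, U, hUo, hne, fun j =>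
    (hW j).trans (closure_mono (bddPeriodLoudSet_subset_loudSet S E ε τ₀ j))⟩

end Summit.AnomalousDissipation.AnomalousDissipation.Cruxes.DenseLoudDesignerForces.StrategistCensusS1

end
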